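import Summits.KontsevichZagierPeriods.Zeta5Search.WedgeDictionaryCoeffV
import Summits.KontsevichZagierPeriods.Zeta5Search.WedgeDictionaryConsequences
import HarnessLib

/-!
# The mixed four-term relation in the slots (2,7) for the canonical coefficients `U`, `W`, `V` — (L1) of the level-descent proof, PROVED

HONEST FRAMING: systematic search; no irrationality claim unless certified.

OUR work (Summit side; planner gen-1 g7, 2026-08-20; memo `pub-zeta5-gen-1/D2-LD-PROOF-g7.md` §1; exact scripts `code/gen1/g7/x5_delta.py`,
`x7_symbolic.py`, `x8_lincomb.py`).  With `N = b₀`, `c_jk := N − b_j − b_k`, `d := dOf b`, `β := b − e₂ − e₇` (`mixedBase`),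
`Π₂ := ∏_{j∈{1,3,4,5,6}} (c_2j + 1)` (`mixedPi2`), `Π₇ := ∏_{j∈{1,3,4,5,6}} (c_7j + 1)` (`mixedPi7`) and
`δ(b) := −(b₂−b₇)·[topGamma2 β − topGamma3 β·(b₂−b₇−2)·c₂₇]` (`mixedDelta`), the statement `mixedRelation` says: for `Z ∈ {U, W, V}` and `b` with
`InBox b`, `0 ≤ d`, `1 ≤ b₂`, `1 ≤ b₇`, `b₂ + b₇ ≤ N`, `b_j ≤ N (j = 1..7)`:

  `(b₂−b₇)(d+1)·Z(b+e₇) + δ(b)·Z(b) + b₂Π₂·Z(b−e₂) − b₇Π₇·Z(b−e₇) = 0`.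

PROOF (`mixedRelation_holds`, no `sorry`): a LINEAR COMBINATION of four tree theorems — the slot-7 four-term relation at the base `β`
(`fourTerm_coeff_rel` / `fourTerm_coeffV_rel`: `γ₃Z(β+3e₇) + γ₂Z(β+2e₇) + γ₁Z(β+e₇) + γ₀Z(β) = 0`, `γ_r = topGamma_r β`) and three instances of
`coeff_update_sub` in the slots 2, 7 (`Z(a+e₂) − Z(a+e₇) = (a₂−a₇)(N−a₂−a₇)·Z(a)` at `a = β`, `b − e₂`, `b − e₂ + e₇`), which eliminate `Z(β)`,
`Z(b−e₂+e₇)`, `Z(b−e₂+2e₇)`; the three scalar facts that make the coefficients come out are `topGamma3 β = −(d+1)` (`topGamma3_eq`),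
`topGamma0 β = b₇(c₂₇+2)Π₇` (`topGamma0_eq`) and ONE new polynomial identity for `topGamma1 β` (`mixed_gamma1_identity`, by `ring`); finally the
common factor `c₂₇ + 2 ≥ 2` is cancelled (`mixedRel_of_rels`).  Consequence for the level descent: (L2) cross-contiguity of the slot-7 wedges
(`WedgeDictionaryCrossContiguity`, `crossRel_of_mixedRel`).  What this is NOT: anything about irrationality; everything here is an identity between the
rational numbers `coeffU`, `coeffW`, `coeffV` of `WedgeDictionary`.
-/

open Finset

namespace Summit.KontsevichZagierPeriods.Zeta5Search.WedgeDictionary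

open Summit.KontsevichZagierPeriods.Zeta5Search.DualSeries

/-- The shape `b` lowered by one in slot `k` (`b − e_k`). -/
def lowerSlot (b : ℕ → ℤ) (k : ℕ) : ℕ → ℤ := Function.update b k (b k - 1)

/-- The base shape `β = b − e₂ − e₇` of the mixed relation. -/
def mixedBase (b : ℕ → ℤ) : ℕ → ℤ := lowerSlot (lowerSlot b 2) 7

/-- `Π₂ = ∏_{j∈{1,3,4,5,6}} (N − b₂ − b_j + 1)`. -/
def mixedPi2 (b : ℕ → ℤ) : ℚ := ∏ j ∈ ({1, 3, 4, 5, 6} : Finset ℕ), ((b 0 : ℚ) - b 2 - b j + 1)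

/-- `Π₇ = ∏_{j∈{1,3,4,5,6}} (N − b₇ − b_j + 1)`. -/
def mixedPi7 (b : ℕ → ℤ) : ℚ := ∏ j ∈ ({1, 3, 4, 5, 6} : Finset ℕ), ((b 0 : ℚ) - b 7 - b j + 1)

/-- `δ(b) = −(b₂−b₇)·[γ₂(β) − γ₃(β)·(b₂−b₇−2)·(N−b₂−b₇)]`, `γ_r = topGamma_r`, `β = mixedBase b`. -/
def mixedDelta (b : ℕ → ℤ) : ℚ :=
  -(((b 2 : ℚ) - b 7) *
    (topGamma2 (mixedBase b) - topGamma3 (mixedBase b) * ((b 2 : ℚ) - b 7 - 2) * ((b 0 : ℚ) - b 2 - b 7)))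

/-- The mixed four-term relation for a coefficient functional `Z`:
`(b₂−b₇)(d+1)·Z(b+e₇) + δ(b)·Z(b) + b₂Π₂·Z(b−e₂) − b₇Π₇·Z(b−e₇) = 0`. -/
def MixedRel (Z : (ℕ → ℤ) → ℚ) (b : ℕ → ℤ) : Prop :=
  ((b 2 : ℚ) - b 7) * ((dOf b : ℚ) + 1) * Z (bump b 6) + mixedDelta b * Z b +
      (b 2 : ℚ) * mixedPi2 b * Z (lowerSlot b 2) - (b 7 : ℚ) * mixedPi7 b * Z (lowerSlot b 7) = 0

/-- Hypotheses of the mixed relation: box-type bounds, `d ≥ 0`, `b₂, b₇ ≥ 1`, `b₂ + b₇ ≤ N`. -/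
def MixedHyp (b : ℕ → ℤ) : Prop :=
  InBox b ∧ 0 ≤ dOf b ∧ 1 ≤ b 2 ∧ 1 ≤ b 7 ∧ b 2 + b 7 ≤ b 0 ∧ ∀ j ∈ Icc 1 7, b j ≤ b 0

/-- **(L1) (memo §1; INTERNALLY MINTED, now PROVED below as `mixedRelation_holds`): the mixed four-term relation for `U`, `W`, `V`.** -/
@[conjecture] def mixedRelation : Prop :=
  ∀ b : ℕ → ℤ, MixedHyp b → MixedRel coeffU b ∧ MixedRel coeffW b ∧ MixedRel coeffV b

/-! ## Entries and shapes -/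

section entries
set_option linter.unusedSimpArgs false
variable (b : ℕ → ℤ)

/-- Entries of `b − e₂`. -/
theorem lowerSlot2_apply (s : ℕ) : lowerSlot b 2 s = if s = 2 then b 2 - 1 else b s := by
  simp [lowerSlot, Function.update_apply]

/-- Entries of `β = b − e₂ − e₇`. -/
theorem mixedBase_apply (s : ℕ) : mixedBase b s = if s = 7 then b 7 - 1 else if s = 2 then b 2 - 1 else b s := by
  simp only [mixedBase, lowerSlot, Function.update_apply]
  split_ifs <;> simp_all

/-- Entries of `f + e₇`. -/
theorem bump6_apply (f : ℕ → ℤ) (s : ℕ) : bump f 6 s = if s = 7 then f 7 + 1 else f s := by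
  simp [bump, Function.update_apply]

/-- `β + e₇ = b − e₂`. -/
theorem bump_mixedBase : bump (mixedBase b) 6 = lowerSlot b 2 := by
  funext s
  by_cases h7 : s = 7
  · subst h7; simp [bump, lowerSlot, mixedBase]
  · by_cases h2 : s = 2
    · subst h2; simp [bump, lowerSlot, mixedBase]
    · simp [bump, lowerSlot, mixedBase, h7, h2]
/-- `β + e₂ = b − e₇`. -/
theorem update2_mixedBase : Function.update (mixedBase b) 2 (mixedBase b 2 + 1) = lowerSlot b 7 := by
  funext s
  by_cases h7 : s = 7
  · subst h7; simp [bump, lowerSlot, mixedBase]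
  · by_cases h2 : s = 2
    · subst h2; simp [bump, lowerSlot, mixedBase]
    · simp [bump, lowerSlot, mixedBase, h7, h2]
/-- `β + e₇ = b − e₂` (update form). -/
theorem update7_mixedBase : Function.update (mixedBase b) 7 (mixedBase b 7 + 1) = lowerSlot b 2 := by
  funext s
  by_cases h7 : s = 7
  · subst h7; simp [bump, lowerSlot, mixedBase]
  · by_cases h2 : s = 2
    · subst h2; simp [bump, lowerSlot, mixedBase]
    · simp [bump, lowerSlot, mixedBase, h7, h2]
/-- `(b − e₂) + e₂ = b`. -/
theorem update2_lowerSlot2 : Function.update (lowerSlot b 2) 2 (lowerSlot b 2 2 + 1) = b := by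
  funext s
  by_cases h7 : s = 7
  · subst h7; simp [bump, lowerSlot, mixedBase]
  · by_cases h2 : s = 2
    · subst h2; simp [bump, lowerSlot, mixedBase]
    · simp [bump, lowerSlot, mixedBase, h7, h2]
/-- `(b − e₂) + e₇` (update form) is `bump (b − e₂) 6`. -/
theorem update7_lowerSlot2 : Function.update (lowerSlot b 2) 7 (lowerSlot b 2 7 + 1) = bump (lowerSlot b 2) 6 := by
  simp only [bump, Nat.reduceAdd]
/-- `(b − e₂ + e₇) + e₂ = b + e₇`. -/
theorem update2_bump_lowerSlot2 :
    Function.update (bump (lowerSlot b 2) 6) 2 (bump (lowerSlot b 2) 6 2 + 1) = bump b 6 := by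
  funext s
  by_cases h7 : s = 7
  · subst h7; simp [bump, lowerSlot, mixedBase]
  · by_cases h2 : s = 2
    · subst h2; simp [bump, lowerSlot, mixedBase]
    · simp [bump, lowerSlot, mixedBase, h7, h2]
/-- `(b − e₂ + e₇) + e₇ = bump (bump (b − e₂) 6) 6`. -/
theorem update7_bump_lowerSlot2 :
    Function.update (bump (lowerSlot b 2) 6) 7 (bump (lowerSlot b 2) 6 7 + 1) = bump (bump (lowerSlot b 2) 6) 6 := by
  simp only [bump, Nat.reduceAdd]
/-- Entries used by the scalar bookkeeping. -/
theorem mixedBase_zero : mixedBase b 0 = b 0 := by simp [mixedBase_apply]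
/-- `β₂ = b₂ − 1`. -/
theorem mixedBase_two : mixedBase b 2 = b 2 - 1 := by simp [mixedBase_apply]
/-- `β₇ = b₇ − 1`. -/
theorem mixedBase_seven : mixedBase b 7 = b 7 - 1 := by simp [mixedBase_apply]
/-- `(b − e₂)₀ = N`. -/
theorem lowerSlot2_zero : lowerSlot b 2 0 = b 0 := by simp [lowerSlot2_apply]
/-- `(b − e₂)₂ = b₂ − 1`. -/
theorem lowerSlot2_two : lowerSlot b 2 2 = b 2 - 1 := by simp [lowerSlot2_apply]
/-- `(b − e₂)₇ = b₇`. -/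
theorem lowerSlot2_seven : lowerSlot b 2 7 = b 7 := by simp [lowerSlot2_apply]
/-- `(b − e₂ + e₇)₀ = N`. -/
theorem bumpLower_zero : bump (lowerSlot b 2) 6 0 = b 0 := by simp [bump6_apply, lowerSlot2_apply]
/-- `(b − e₂ + e₇)₂ = b₂ − 1`. -/
theorem bumpLower_two : bump (lowerSlot b 2) 6 2 = b 2 - 1 := by simp [bump6_apply, lowerSlot2_apply]
/-- `(b − e₂ + e₇)₇ = b₇ + 1`. -/
theorem bumpLower_seven : bump (lowerSlot b 2) 6 7 = b 7 + 1 := by simp [bump6_apply, lowerSlot2_apply]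

/-- `d(β) = d + 2`. -/
theorem dOf_mixedBase : dOf (mixedBase b) = dOf b + 2 := by
  simp only [dOf, sum_range_succ, sum_range_zero, Nat.reduceAdd, mixedBase_apply]; simp; ring
/-- `d(b − e₂) = d + 1`. -/
theorem dOf_lowerSlot2 : dOf (lowerSlot b 2) = dOf b + 1 := by
  simp only [dOf, sum_range_succ, sum_range_zero, Nat.reduceAdd, lowerSlot2_apply]; simp; ring
/-- `d(b − e₂ + e₇) = d`. -/
theorem dOf_bump_lowerSlot2 : dOf (bump (lowerSlot b 2) 6) = dOf b := by
  simp only [dOf, sum_range_succ, sum_range_zero, Nat.reduceAdd, bump6_apply, lowerSlot2_apply]; simp; ring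

/-- `InBox` spelled out slot by slot. -/
theorem inBox_iff (a : ℕ → ℤ) : InBox a ↔ 0 ≤ a 0 ∧ (0 ≤ a 1 ∧ a 1 ≤ a 0 + 1) ∧ (0 ≤ a 2 ∧ a 2 ≤ a 0 + 1) ∧
    (0 ≤ a 3 ∧ a 3 ≤ a 0 + 1) ∧ (0 ≤ a 4 ∧ a 4 ≤ a 0 + 1) ∧ (0 ≤ a 5 ∧ a 5 ≤ a 0 + 1) ∧ (0 ≤ a 6 ∧ a 6 ≤ a 0 + 1) ∧
    (0 ≤ a 7 ∧ a 7 ≤ a 0 + 1) := by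
  unfold InBox
  constructor
  · rintro ⟨h0, h⟩
    exact ⟨h0, h 0 (by simp), h 1 (by simp), h 2 (by simp), h 3 (by simp), h 4 (by simp), h 5 (by simp), h 6 (by simp)⟩
  · rintro ⟨h0, h1, h2, h3, h4, h5, h6, h7⟩
    refine ⟨h0, ?_⟩
    intro j hj
    simp only [mem_range] at hj
    interval_cases j <;> assumption

end entries

/-! ## The scalar identities -/

/-- `Icc 1 7 = {1,…,7}` (index bookkeeping). -/
theorem Icc_one_seven : (Icc 1 7 : Finset ℕ) = {1, 2, 3, 4, 5, 6, 7} := by decide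

/-- `γ₃(β) = −(d+1)`. -/
theorem mixed_gamma3 (b : ℕ → ℤ) : topGamma3 (mixedBase b) = -((dOf b : ℚ) + 1) := by
  rw [topGamma3_eq, dOf_mixedBase]; push_cast; ring

/-- `γ₀(β) = b₇ (c₂₇ + 2) Π₇`. -/
theorem mixed_gamma0 (b : ℕ → ℤ) :
    topGamma0 (mixedBase b) = (b 7 : ℚ) * ((b 0 : ℚ) - b 2 - b 7 + 2) * mixedPi7 b := by
  rw [topGamma0_eq]
  simp only [prod_range_succ, prod_range_zero, Nat.reduceAdd, mixedBase_apply, mixedPi7]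
  simp
  ring

set_option maxHeartbeats 800000 in
/-- The one new polynomial identity (coefficient of `Z(b−e₂)`):
`(b₂−b₇)·γ₁(β) − b₇Π₇ − (b₂−b₇)[γ₂(β) − γ₃(β)(b₂−b₇−2)c₂₇](b₂−b₇−1)(c₂₇+1) + b₂Π₂ = 0`. -/
theorem mixed_gamma1_identity (b : ℕ → ℤ) :
    ((b 2 : ℚ) - b 7) * topGamma1 (mixedBase b) - (b 7 : ℚ) * mixedPi7 b -
        ((b 2 : ℚ) - b 7) * (topGamma2 (mixedBase b) - topGamma3 (mixedBase b) * ((b 2 : ℚ) - b 7 - 2) * ((b 0 : ℚ) - b 2 - b 7)) *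
          ((b 2 : ℚ) - b 7 - 1) * ((b 0 : ℚ) - b 2 - b 7 + 1) + (b 2 : ℚ) * mixedPi2 b = 0 := by
  simp only [topGamma1, topGamma2, topGamma3, topA1, topA2, topA3, yNode, fe1, fe2, fe3, fe4, fe5, mixedBase_apply, mixedPi2,
    mixedPi7]
  simp
  ring

/-- The algebraic core: the four relations and the three scalar facts give `(c₂₇+2)·(mixed relation)`, and `c₂₇ + 2 ≠ 0` is cancelled.
`s2`, `s3` stand for the shapes `b − e₂ + e₇`, `b − e₂ + 2e₇` (eliminated). -/
theorem mixedRel_of_rels (Z : (ℕ → ℤ) → ℚ) (b s2 s3 : ℕ → ℤ)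
    (T7 : topGamma3 (mixedBase b) * Z s3 + topGamma2 (mixedBase b) * Z s2 + topGamma1 (mixedBase b) * Z (lowerSlot b 2) +
        topGamma0 (mixedBase b) * Z (mixedBase b) = 0)
    (S0 : Z (lowerSlot b 7) - Z (lowerSlot b 2) = ((b 2 : ℚ) - b 7) * ((b 0 : ℚ) - b 2 - b 7 + 2) * Z (mixedBase b))
    (S1 : Z b - Z s2 = ((b 2 : ℚ) - b 7 - 1) * ((b 0 : ℚ) - b 2 - b 7 + 1) * Z (lowerSlot b 2))
    (S2 : Z (bump b 6) - Z s3 = ((b 2 : ℚ) - b 7 - 2) * ((b 0 : ℚ) - b 2 - b 7) * Z s2)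
    (hc : ((b 0 : ℚ) - b 2 - b 7 + 2) ≠ 0) : MixedRel Z b := by
  have hG3 := mixed_gamma3 b
  have hG0 := mixed_gamma0 b
  have hG1 := mixed_gamma1_identity b
  unfold MixedRel mixedDelta
  have key : ((b 0 : ℚ) - b 2 - b 7 + 2) *
      (((b 2 : ℚ) - b 7) * ((dOf b : ℚ) + 1) * Z (bump b 6) +
        -(((b 2 : ℚ) - b 7) * (topGamma2 (mixedBase b) - topGamma3 (mixedBase b) * ((b 2 : ℚ) - b 7 - 2) * ((b 0 : ℚ) - b 2 - b 7))) * Z b +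
        (b 2 : ℚ) * mixedPi2 b * Z (lowerSlot b 2) - (b 7 : ℚ) * mixedPi7 b * Z (lowerSlot b 7)) = 0 := by
    linear_combination (-(((b 2 : ℚ) - b 7) * ((b 0 : ℚ) - b 2 - b 7 + 2))) * T7 +
      (-(topGamma0 (mixedBase b))) * S0 +
      (((b 0 : ℚ) - b 2 - b 7 + 2) * (-(((b 2 : ℚ) - b 7) *
        (topGamma2 (mixedBase b) - topGamma3 (mixedBase b) * ((b 2 : ℚ) - b 7 - 2) * ((b 0 : ℚ) - b 2 - b 7))))) * S1 +
      (-(((b 2 : ℚ) - b 7) * ((b 0 : ℚ) - b 2 - b 7 + 2) * topGamma3 (mixedBase b))) * S2 +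
      (((b 2 : ℚ) - b 7) * ((b 0 : ℚ) - b 2 - b 7 + 2) * Z (bump b 6)) * hG3 +
      (Z (lowerSlot b 7) - Z (lowerSlot b 2)) * hG0 +
      (((b 0 : ℚ) - b 2 - b 7 + 2) * Z (lowerSlot b 2)) * hG1
  rcases mul_eq_zero.mp key with h | h
  · exact absurd h hc
  · exact h

/-! ## (L1) for `U`, `W`, `V` -/

set_option maxHeartbeats 800000 in
/-- **(L1) PROVED.** The mixed four-term relation for the canonical coefficients `U`, `W`, `V` under `MixedHyp`. -/
theorem mixedRelation_holds : mixedRelation := by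
  intro b hyp
  obtain ⟨hb, hd, hb2, hb7, h27, hle⟩ := hyp
  obtain ⟨h0, h1, h2, h3, h4, h5, h6, h7⟩ := (inBox_iff b).1 hb
  simp only [Icc_one_seven, mem_insert, mem_singleton, forall_eq_or_imp, forall_eq] at hle
  obtain ⟨hl1, hl2, hl3, hl4, hl5, hl6, hl7⟩ := hle
  -- the base β and the two intermediate shapes
  have hβ : InBox (mixedBase b) := by
    rw [inBox_iff]; simp only [mixedBase_apply]; simp; omega
  have hdβ : 2 ≤ dOf (mixedBase b) := by rw [dOf_mixedBase]; omega
  have h7β : mixedBase b 7 + 2 ≤ mixedBase b 0 := by simp only [mixedBase_apply]; simp; omega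
  have hL2 : InBox (lowerSlot b 2) := by
    rw [inBox_iff]; simp only [lowerSlot2_apply]; simp; omega
  have hdL2 : 0 ≤ dOf (lowerSlot b 2) := by rw [dOf_lowerSlot2]; omega
  have hS2 : InBox (bump (lowerSlot b 2) 6) := by
    rw [inBox_iff]; simp only [bump6_apply, lowerSlot2_apply]; simp; omega
  have hdS2 : 0 ≤ dOf (bump (lowerSlot b 2) 6) := by rw [dOf_bump_lowerSlot2]; omega
  have hi : (1 : ℕ) ∈ range 7 := by simp
  have hk : (6 : ℕ) ∈ range 7 := by simp
  -- the four tree relations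
  have T := fourTerm_coeff_rel (mixedBase b) hβ hdβ h7β
  have TV := fourTerm_coeffV_rel (mixedBase b) hβ hdβ h7β
  have S0 := coeff_update_sub (mixedBase b) hβ (by omega) hi hk
    (by simp only [Nat.reduceAdd, mixedBase_apply]; simp; omega) (by simp only [Nat.reduceAdd, mixedBase_apply]; simp; omega)
  have S1 := coeff_update_sub (lowerSlot b 2) hL2 hdL2 hi hk
    (by simp only [Nat.reduceAdd, lowerSlot2_apply]; simp; omega) (by simp only [Nat.reduceAdd, lowerSlot2_apply]; simp; omega)
  have S2 := coeff_update_sub (bump (lowerSlot b 2) 6) hS2 hdS2 hi hk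
    (by simp only [Nat.reduceAdd, bump6_apply, lowerSlot2_apply]; simp; omega)
    (by simp only [Nat.reduceAdd, bump6_apply, lowerSlot2_apply]; simp; omega)
  simp only [Nat.reduceAdd] at S0 S1 S2
  rw [update2_mixedBase, update7_mixedBase] at S0
  rw [update2_lowerSlot2, update7_lowerSlot2] at S1
  rw [update2_bump_lowerSlot2, update7_bump_lowerSlot2] at S2
  rw [bump_mixedBase] at T TV
  -- the scalar coefficients of the `S` relations, in terms of `b`
  have c0 : (((mixedBase b 2 - mixedBase b 7) * (mixedBase b 0 - mixedBase b 2 - mixedBase b 7) : ℤ) : ℚ) =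
      ((b 2 : ℚ) - b 7) * ((b 0 : ℚ) - b 2 - b 7 + 2) := by
    rw [mixedBase_zero, mixedBase_two, mixedBase_seven]; push_cast; ring
  have c1 : (((lowerSlot b 2 2 - lowerSlot b 2 7) * (lowerSlot b 2 0 - lowerSlot b 2 2 - lowerSlot b 2 7) : ℤ) : ℚ) =
      ((b 2 : ℚ) - b 7 - 1) * ((b 0 : ℚ) - b 2 - b 7 + 1) := by
    rw [lowerSlot2_zero, lowerSlot2_two, lowerSlot2_seven]; push_cast; ring
  have c2 : (((bump (lowerSlot b 2) 6 2 - bump (lowerSlot b 2) 6 7) *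
      (bump (lowerSlot b 2) 6 0 - bump (lowerSlot b 2) 6 2 - bump (lowerSlot b 2) 6 7) : ℤ) : ℚ) =
      ((b 2 : ℚ) - b 7 - 2) * ((b 0 : ℚ) - b 2 - b 7) := by
    rw [bumpLower_zero, bumpLower_two, bumpLower_seven]; push_cast; ring
  push_cast at c0 c1 c2 S0 S1 S2
  rw [c0] at S0; rw [c1] at S1; rw [c2] at S2
  have hc : ((b 0 : ℚ) - b 2 - b 7 + 2) ≠ 0 := by
    have : (0 : ℚ) < (b 0 : ℚ) - b 2 - b 7 + 2 := by
      have h' : (0 : ℤ) < b 0 - b 2 - b 7 + 2 := by omega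
      exact_mod_cast h'
    exact this.ne'
  refine ⟨?_, ?_, ?_⟩
  · exact mixedRel_of_rels coeffU b _ _ T.1 S0.1 S1.1 S2.1 hc
  · exact mixedRel_of_rels coeffW b _ _ T.2 S0.2.1 S1.2.1 S2.2.1 hc
  · exact mixedRel_of_rels coeffV b _ _ TV S0.2.2 S1.2.2 S2.2.2 hc

end Summit.KontsevichZagierPeriods.Zeta5Search.WedgeDictionary
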